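import Mathlib.Analysis.SpecialFunctions.Integrals.Basic
import Mathlib.Analysis.SpecialFunctions.Trigonometric.Inverse
import Mathlib.Analysis.SpecialFunctions.Trigonometric.Chebyshev.Basic
import Mathlib.Analysis.SpecialFunctions.Pow.Real
import Mathlib.MeasureTheory.Integral.IntervalIntegral.Periodic
import Mathlib.MeasureTheory.Integral.IntervalIntegral.IntegrationByParts
import HarnessLib

/-!
# Murty–Sinha's effective equidistribution, II: Serre's measure `μ_p` in the angle variable
# (Weyl limits of Thm. 18, change of variables, arc counting)

Sibling file of `Literature.NumberTheory.EllipticCurves.MurtySinhaEquidistribution`, which vendors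
M. R. Murty, K. Sinha, *Effective equidistribution of eigenvalues of Hecke operators*, J. Number
Theory **129** (2009) 681–714 [MurtySinha2009], **Theorem 2** (p. 682) in weight `2` as the named
fact `murtySinha2009_thm2_weightTwo`. Of the three ingredients of the printed proof (Thm. 8 =
Erdős–Turán for the `μ`-discrepancy; the trace formula with the Weyl limits of Thm. 18; the
bookkeeping of §10) this file supplies the **measure-theoretic side of Thm. 18 and §§9–10**, with
no modular forms:

* `kmDensity p θ = ((p+1)/π) sin²θ/(p + 1/p - 2cos 2θ)` — Serre's measure `μ_p` transported to the
  angle `θ` (`a_p = 2√p cos θ`) and symmetrised to `±θ ∈ [-π, π]`, i.e. `½ F(-x) dx` of §9 (p. 698)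
  with `θ = 2πx`: continuous, `2π`-periodic, even, `0 ≤ g_p ≤ (p+1)p/(π(p-1)²) ≤ 6/π` (`p ≥ 2`);
* its Fourier coefficients = the **Weyl limits of Thm. 18** (p. 698): `∫_{-π}^{π} g_p = 1`,
  `2∫ g_p cos(mθ) = p^{-m/2} - p^{-(m-2)/2}` for even `m ≥ 2`, `= 0` for odd `m`, `∫ g_p sin(m·) = 0`
  (`integral_kmDensity`, `integral_kmDensity_mul_cos_even/odd`, `integral_kmDensity_mul_sin`).
  **Deviation from print (method):** loc. cit. sums the Poisson-type series
  `F(x) = Σ_m c_m e(mx) = 2 + 2Σ_{m≥1}(p^{-m} - p^{-(m-1)}) cos 4πmx`; we avoid series: the cosine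
  transforms `J_p(c) = ∫ cos(cθ)/(p + 1/p - 2cos 2θ)` satisfy the three-term relation
  `(p + 1/p)J_p(c) - J_p(c+2) - J_p(c-2) = ∫ cos(cθ)` (`kmJ_rec`) and are bounded (`abs_kmJ_le`), which
  forces the decaying solution `J_p(2a) = J_p(0) p^{-a}` and the value `J_p(0) = 2πp/(p²-1)`
  (`kmJ_two_mul`); odd frequencies vanish by `θ ↦ π - θ` (`kmJ_odd`);
* the **change of variables** `t = 2√p cos θ` from the integrand of the vendored statement
  (`serreDensity p t = (p+1)√(4p-t²)/(2π((p+1)²-t²))`, Thm. 1 p. 682 in the variable `t = √p x`) to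
  `2 g_p(θ) dθ` (`integral_serreDensity_eq`, §9 p. 698 "after an easy change of variable");
* the **arc bookkeeping of §10** (p. 700: the angles `±θ_i/2π` and the two intervals `I₁ ⊆ [0, ½]`,
  `I₂ ⊆ [½, 1]`): `arcCount u v P = #{k : u ≤ P + 2πk < v}` and the two inequalities
  `two_mul_card_le_arcCount`, `arcCount_le_two_mul_card` comparing `2·#{i : θ_i ∈ [θ_b, θ_a]}` with
  the lift counts of the points `±θ_i` in `δ`-enlarged / `δ`-shrunken arcs (closed intervals of
  eigenvalues versus the half-open arcs counted by the Erdős–Turán inequality of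
  `Literature.Analysis.Fourier.ErdosTuranDiscrepancy`);
* `2cos mθ = X_m(2cos θ) - X_{m-2}(2cos θ)` (§8 p. 697) from Mathlib's Chebyshev `T`/`U`.

The combination with the Erdős–Turán inequality and the trace formula (Murty–Sinha Thm. 19 and
Thm. 2 in weight `2`) is in `MurtySinhaEquidistributionOfTraceFormula`.

## References

* [MurtySinha2009] §8 (p. 697: `X_m`, Lemma 17), §9 (p. 697–698: `μ_p`, `F`), Thm. 18 (p. 698),
  §10 (p. 699–700). Held: `paper:doi-10-1016-j-jnt-2008-10-010` (PDF page = journal page − 679).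
* J.-P. Serre, J. Amer. Math. Soc. 10 (1997) 75–102, §2 (the measure `μ_p`; quoted from loc. cit.).

Mathlib: `Polynomial.Chebyshev.T_real_cos`, `two_mul_T_eq_U_sub_U`, `Real.cos_arccos`,
`intervalIntegral.integral_comp_mul_deriv'`, `pow_unbounded_of_one_lt`; no Kesten–McKay / Serre
measure in Mathlib or the tree (`lean search 'kesten|mcKay|serreMeasure|plancherel.*tree'`, 2026-08-15).
-/

noncomputable section

open Real MeasureTheory intervalIntegral Finset

namespace Literature.NumberTheory.EllipticCurves.ModularForms

namespace MurtySinha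
/-! ### Serre's measure `μ_p` in the angle variable (Kesten–McKay density) -/

/-- The denominator `p + 1/p - 2 cos 2θ = |√p - e^{2iθ}/√p|²` of Serre's measure in the angle
variable (Murty–Sinha §9, p. 698: `F(x) = 4(p+1) sin² 2πx / ((p^{1/2} + p^{-1/2})² - 4cos² 2πx)`,
`θ = 2πx`). [cite: MurtySinha2009, §9 p. 698] -/
noncomputable def kmDenom (p θ : ℝ) : ℝ := p + p⁻¹ - 2 * Real.cos (2 * θ)

/-- **Serre's measure `μ_p` in the angle variable** (the Kesten–McKay / Plancherel density of the
`(p+1)`-regular tree pushed to `θ`, `a_p = 2√p cos θ`): `g_p(θ) = ((p+1)/π) sin²θ / (p + 1/p - 2cos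
2θ)`, normalised to be a probability density on `[-π, π]` (`integral_kmDensity`), i.e. half of
Murty–Sinha's `F(-x) dx` on `[0, 1] ∋ x = θ/2π` (§9, p. 698) placed symmetrically at `±θ`. Its
cosine coefficients are half the Weyl limits `c_m` of Thm. 18: `2∫ g_p cos(mθ) = p^{-m/2} -
p^{-(m-2)/2}` (`m ≥ 2` even), `0` (`m` odd) (`integral_kmDensity_mul_cos_even/odd`). [cite:
MurtySinha2009, §9 p. 698 and Thm. 18 p. 698] -/
noncomputable def kmDensity (p θ : ℝ) : ℝ := (p + 1) / π * Real.sin θ ^ 2 / kmDenom p θ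

section Basic

/-- `p + 1/p - 2cos 2θ ≥ (p-1)²/p`. [folklore] -/
theorem kmDenom_lower {p : ℝ} (hp : 1 < p) (θ : ℝ) : (p - 1) ^ 2 / p ≤ kmDenom p θ := by
  have hp0 : 0 < p := by linarith
  have hc := Real.cos_le_one (2 * θ)
  rw [kmDenom]
  have : (p - 1) ^ 2 / p = p + p⁻¹ - 2 := by field_simp; ring
  rw [this]
  linarith

/-- `(p-1)²/p > 0` for `p > 1`. [folklore] -/
theorem sub_one_sq_div_pos {p : ℝ} (hp : 1 < p) : 0 < (p - 1) ^ 2 / p := by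
  have hp0 : 0 < p := by linarith
  have : 0 < p - 1 := by linarith
  positivity

/-- The denominator is positive for `p > 1`. [folklore] -/
theorem kmDenom_pos {p : ℝ} (hp : 1 < p) (θ : ℝ) : 0 < kmDenom p θ :=
  lt_of_lt_of_le (sub_one_sq_div_pos hp) (kmDenom_lower hp θ)

/-- The denominator is continuous. [folklore] -/
theorem continuous_kmDenom (p : ℝ) : Continuous (kmDenom p) := by
  unfold kmDenom; fun_prop

/-- `g_p` is continuous (`p > 1`). [folklore] -/
theorem continuous_kmDensity {p : ℝ} (hp : 1 < p) : Continuous (kmDensity p) := by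
  unfold kmDensity
  exact ((continuous_const.mul (Real.continuous_sin.pow 2)).div (continuous_kmDenom p)
    fun θ => (kmDenom_pos hp θ).ne')

/-- The denominator has period `2π`. [folklore] -/
theorem kmDenom_add_two_pi (p θ : ℝ) : kmDenom p (θ + 2 * π) = kmDenom p θ := by
  rw [kmDenom, kmDenom, mul_add, show 2 * (2 * π) = ((2 : ℕ) : ℝ) * (2 * π) by norm_num,
    Real.cos_add_nat_mul_two_pi]

/-- The denominator is even. [folklore] -/
theorem kmDenom_neg (p θ : ℝ) : kmDenom p (-θ) = kmDenom p θ := by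
  rw [kmDenom, kmDenom, mul_neg, Real.cos_neg]

/-- The denominator is invariant under `θ ↦ π - θ`. [folklore] -/
theorem kmDenom_pi_sub (p θ : ℝ) : kmDenom p (π - θ) = kmDenom p θ := by
  rw [kmDenom, kmDenom, mul_sub, show 2 * π - 2 * θ = -(2 * θ) + ((1 : ℕ) : ℝ) * (2 * π) by ring,
    Real.cos_add_nat_mul_two_pi, Real.cos_neg]

/-- `g_p` has period `2π`. [folklore] -/
theorem kmDensity_add_two_pi (p θ : ℝ) : kmDensity p (θ + 2 * π) = kmDensity p θ := by
  rw [kmDensity, kmDensity, kmDenom_add_two_pi p,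
    show θ + 2 * π = θ + ((1 : ℕ) : ℝ) * (2 * π) by ring, Real.sin_add_nat_mul_two_pi]

/-- `g_p` has period `2π`. [folklore] -/
theorem kmDensity_periodic (p : ℝ) : Function.Periodic (kmDensity p) (2 * π) :=
  kmDensity_add_two_pi p

/-- `g_p` is even. [folklore] -/
theorem kmDensity_neg (p θ : ℝ) : kmDensity p (-θ) = kmDensity p θ := by
  rw [kmDensity, kmDensity, kmDenom_neg p, Real.sin_neg, neg_sq]

/-- `g_p ≥ 0` (`p > 1`). [folklore] -/
theorem kmDensity_nonneg {p : ℝ} (hp : 1 < p) (θ : ℝ) : 0 ≤ kmDensity p θ := by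
  have := kmDenom_pos hp θ
  have hp0 : 0 < p := by linarith
  unfold kmDensity
  positivity

/-- `g_p ≤ (p+1)p/(π(p-1)²)` — the quantity `‖μ‖` of Murty–Sinha Thm. 8 for `μ_p`. [folklore] -/
theorem kmDensity_le {p : ℝ} (hp : 1 < p) (θ : ℝ) :
    kmDensity p θ ≤ (p + 1) * p / (π * (p - 1) ^ 2) := by
  have hp0 : 0 < p := by linarith
  have hp1 : 0 < p - 1 := by linarith
  have hD := kmDenom_lower hp θ
  have hD0 := kmDenom_pos hp θ
  have hs : Real.sin θ ^ 2 ≤ 1 := Real.sin_sq_le_one θ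
  unfold kmDensity
  rw [div_le_div_iff₀ hD0 (by positivity)]
  calc (p + 1) / π * Real.sin θ ^ 2 * (π * (p - 1) ^ 2)
      = (p + 1) * (p - 1) ^ 2 * Real.sin θ ^ 2 := by field_simp
    _ ≤ (p + 1) * (p - 1) ^ 2 * 1 := by gcongr
    _ = (p + 1) * p * ((p - 1) ^ 2 / p) := by field_simp
    _ ≤ (p + 1) * p * kmDenom p θ := by gcongr

end Basic

/-- `g_p ≤ 6/π` uniformly in `p ≥ 2`. [folklore] -/
theorem kmDensity_le_six_div_pi {p : ℝ} (hp : 2 ≤ p) (θ : ℝ) : kmDensity p θ ≤ 6 / π := by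
  refine (kmDensity_le (by linarith) θ).trans ?_
  have hp1 : 0 < p - 1 := by linarith
  rw [div_le_div_iff₀ (by positivity) Real.pi_pos]
  nlinarith [mul_nonneg (by linarith : (0:ℝ) ≤ 5 * p - 3) (by linarith : (0:ℝ) ≤ p - 2), Real.pi_pos]

/-! ### The Fourier coefficients of `1/(p + 1/p - 2 cos 2θ)` -/

section Fourier

/-- `J_p(c) = ∫_{-π}^{π} cos(cθ)/(p + 1/p - 2cos 2θ) dθ`, the cosine transform of the reciprocal
denominator (for real frequency `c`, so that `c - 2` needs no case distinction). [folklore] -/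
noncomputable def kmJ (p c : ℝ) : ℝ := ∫ θ in (-π)..π, Real.cos (c * θ) / kmDenom p θ

/-- `J_p(-c) = J_p(c)`. [folklore] -/
theorem kmJ_neg (p c : ℝ) : kmJ p (-c) = kmJ p c := by
  simp only [kmJ, neg_mul, Real.cos_neg]

/-- `cos(cθ)/(p + 1/p - 2cos 2θ)` is continuous (`p > 1`). [folklore] -/
theorem continuous_cos_div_kmDenom {p : ℝ} (hp : 1 < p) (c : ℝ) :
    Continuous fun θ => Real.cos (c * θ) / kmDenom p θ :=
  (by fun_prop : Continuous fun θ => Real.cos (c * θ)).div (continuous_kmDenom p)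
    fun θ => (kmDenom_pos hp θ).ne'

/-- **Three-term relation** `(p + 1/p) J_p(c) - J_p(c+2) - J_p(c-2) = ∫_{-π}^{π} cos(cθ) dθ`
(multiply out the denominator, `2cos 2θ cos cθ = cos(c+2)θ + cos(c-2)θ`). [folklore] -/
theorem kmJ_rec {p : ℝ} (hp : 1 < p) (c : ℝ) :
    (p + p⁻¹) * kmJ p c - kmJ p (c + 2) - kmJ p (c - 2) = ∫ θ in (-π)..π, Real.cos (c * θ) := by
  have hi : ∀ c : ℝ, IntervalIntegrable (fun θ => Real.cos (c * θ) / kmDenom p θ) volume (-π) π :=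
    fun c => (continuous_cos_div_kmDenom hp c).intervalIntegrable (-π) π
  unfold kmJ
  rw [← intervalIntegral.integral_const_mul, ← intervalIntegral.integral_sub ((hi c).const_mul _) (hi _),
    ← intervalIntegral.integral_sub (((hi c).const_mul _).sub (hi _)) (hi _)]
  refine intervalIntegral.integral_congr fun θ _ => ?_
  have hD := (kmDenom_pos hp θ).ne'
  have e : Real.cos ((c + 2) * θ) + Real.cos ((c - 2) * θ) =
      2 * Real.cos (c * θ) * Real.cos (2 * θ) := by
    rw [add_mul, sub_mul, Real.cos_add, Real.cos_sub]; ring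
  have key : (p + p⁻¹) * Real.cos (c * θ) - Real.cos ((c + 2) * θ) - Real.cos ((c - 2) * θ) =
      Real.cos (c * θ) * kmDenom p θ := by
    rw [kmDenom]; linear_combination (-1 : ℝ) * e
  rw [mul_div_assoc', ← sub_div, ← sub_div, key, mul_div_cancel_right₀ _ hD]

/-- `|J_p(c)| ≤ 2π p/(p-1)²`, uniformly in `c`. [folklore] -/
theorem abs_kmJ_le {p : ℝ} (hp : 1 < p) (c : ℝ) : |kmJ p c| ≤ 2 * π * (p / (p - 1) ^ 2) := by
  have hp0 : 0 < p := by linarith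
  have hlow := sub_one_sq_div_pos hp
  unfold kmJ
  have h := intervalIntegral.norm_integral_le_of_norm_le_const (a := -π) (b := π)
    (f := fun θ => Real.cos (c * θ) / kmDenom p θ) (C := p / (p - 1) ^ 2) ?_
  · rw [Real.norm_eq_abs] at h
    refine h.trans (le_of_eq ?_)
    rw [sub_neg_eq_add, abs_of_pos (by positivity)]
    ring
  · intro θ _
    rw [Real.norm_eq_abs, abs_div, abs_of_pos (kmDenom_pos hp θ)]
    have h1 : |Real.cos (c * θ)| ≤ 1 := Real.abs_cos_le_one _
    have h2 := kmDenom_lower hp θ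
    have hD0 := kmDenom_pos hp θ
    calc |Real.cos (c * θ)| / kmDenom p θ ≤ 1 / kmDenom p θ := by gcongr
      _ ≤ 1 / ((p - 1) ^ 2 / p) := by gcongr
      _ = p / (p - 1) ^ 2 := by field_simp

/-- `J_p(2a+1) = 0` (the substitution `θ ↦ π - θ` changes the sign of the integrand). [folklore] -/
theorem kmJ_odd (p : ℝ) (a : ℕ) : kmJ p (2 * a + 1) = 0 := by
  set f : ℝ → ℝ := fun θ => Real.cos ((2 * a + 1) * θ) / kmDenom p θ with hf
  have hper : Function.Periodic f (2 * π) := by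
    intro θ
    simp only [hf]
    rw [kmDenom_add_two_pi p, mul_add, show (2 * (a : ℝ) + 1) * (2 * π) = ((2 * a + 1 : ℕ) : ℝ) * (2 * π) by
      push_cast; ring, Real.cos_add_nat_mul_two_pi]
  have hanti : ∀ θ, f (π - θ) = -f θ := by
    intro θ
    simp only [hf]
    rw [kmDenom_pi_sub p, mul_sub, Real.cos_sub,
      show (2 * (a : ℝ) + 1) * π = ((2 * a + 1 : ℕ) : ℝ) * π by push_cast; ring,
      Real.cos_nat_mul_pi, Real.sin_nat_mul_pi]
    rw [pow_succ, pow_mul]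
    norm_num
    ring
  have h1 : ∫ θ in (-π)..π, f (π - θ) = ∫ θ in (-π)..π, f θ := by
    rw [intervalIntegral.integral_comp_sub_left f π, show π - π = 0 by ring,
      show π - -π = 0 + 2 * π by ring, hper.intervalIntegral_add_eq 0 (-π),
      show -π + 2 * π = π by ring]
  have h2 : ∫ θ in (-π)..π, f (π - θ) = -∫ θ in (-π)..π, f θ := by
    simp_rw [hanti]
    exact intervalIntegral.integral_neg
  have : ∫ θ in (-π)..π, f θ = 0 := by linarith
  simpa [kmJ, hf] using this

/-- `∫_{-π}^{π} cos(2kθ) dθ = 2π δ_{k0}`. [folklore] -/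
theorem integral_cos_two_mul_nat (k : ℕ) :
    ∫ θ in (-π)..π, Real.cos (2 * k * θ) = if k = 0 then 2 * π else 0 := by
  split_ifs with hk
  · subst hk; simp; ring
  · have hk' : (2 * k : ℝ) ≠ 0 := by positivity
    rw [intervalIntegral.integral_comp_mul_left (fun x => Real.cos x) hk', integral_cos]
    have h1 : Real.sin (2 * k * π) = 0 := by
      rw [show (2 * k : ℝ) * π = ((2 * k : ℕ) : ℝ) * π by push_cast; ring, Real.sin_nat_mul_pi]
    have h2 : Real.sin (2 * k * -π) = 0 := by rw [mul_neg, Real.sin_neg, h1, neg_zero]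
    simp [h1]

/-- **The even coefficients**: `J_p(2a) = (2πp/(p²-1)) p^{-a}` — the bounded solution of the
recursion `J_p(2a+2) = (p + 1/p) J_p(2a) - J_p(2a-2)`; the growing solution `p^a` is excluded by
`abs_kmJ_le`, which also determines `J_p(0) = 2πp/(p²-1)` (the Poisson kernel `Σ_n p^{-|n|}
e^{2inθ}` of Murty–Sinha §9 without summing a series). [cite: MurtySinha2009, §9 p. 698
(computation of F)] -/
theorem kmJ_two_mul {p : ℝ} (hp : 1 < p) (a : ℕ) :
    kmJ p (2 * a) = 2 * π * p / (p ^ 2 - 1) * (p⁻¹) ^ a := by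
  have hp0 : 0 < p := by linarith
  have hpne : p ≠ 0 := hp0.ne'
  have hp21 : p ^ 2 - 1 ≠ 0 := by nlinarith
  set q : ℝ := p⁻¹ with hq_def
  have hq1 : q < 1 := inv_lt_one_of_one_lt₀ hp
  have hq0 : 0 < q := inv_pos.mpr hp0
  have hq : p - q ≠ 0 := by linarith
  have hpinv : p * q = 1 := mul_inv_cancel₀ hpne
  set e : ℕ → ℝ := fun a => kmJ p (2 * a) with he
  -- the recursion
  have hrec0 : (p + q) * e 0 - 2 * e 1 = 2 * π := by
    have h := kmJ_rec hp 0
    rw [zero_sub, kmJ_neg, zero_add] at h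
    have h0 := integral_cos_two_mul_nat 0
    simp only [Nat.cast_zero, mul_zero, if_true] at h0
    simp only [he, Nat.cast_zero, Nat.cast_one, mul_zero, mul_one]
    linarith [h, h0]
  have hrec : ∀ a : ℕ, e (a + 2) = (p + q) * e (a + 1) - e a := by
    intro a
    have h := kmJ_rec hp (2 * (a + 1 : ℕ))
    have h0 := integral_cos_two_mul_nat (a + 1)
    rw [if_neg (Nat.succ_ne_zero a)] at h0
    push_cast at h h0
    rw [h0, show (2 : ℝ) * (a + 1) + 2 = 2 * (a + 2) by ring,
      show (2 : ℝ) * (a + 1) - 2 = 2 * a by ring] at h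
    simp only [he]
    push_cast
    linarith
  -- closed form `e a = A p^a + B q^a`
  set A : ℝ := (e 1 - e 0 * q) / (p - q) with hA
  set B : ℝ := (e 0 * p - e 1) / (p - q) with hB
  have hform : ∀ a : ℕ, e a = A * p ^ a + B * q ^ a := by
    have key : ∀ a : ℕ, e a = A * p ^ a + B * q ^ a ∧
        e (a + 1) = A * p ^ (a + 1) + B * q ^ (a + 1) := by
      intro a
      induction a with
      | zero =>
        refine ⟨?_, ?_⟩
        · simp only [pow_zero, mul_one, hA, hB]
          field_simp
          ring
        · simp only [zero_add, pow_one, hA, hB]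
          field_simp
          ring
      | succ a ih =>
        refine ⟨ih.2, ?_⟩
        rw [hrec a, ih.1, ih.2]
        linear_combination (A * p ^ a + B * q ^ a) * hpinv
    exact fun a => (key a).1
  -- boundedness forces `A = 0`
  have hAz : A = 0 := by
    by_contra hAz
    have hApos : 0 < |A| := abs_pos.mpr hAz
    set C : ℝ := 2 * π * (p / (p - 1) ^ 2) with hC
    have hbd : ∀ a : ℕ, |A| * p ^ a ≤ C + |B| := by
      intro a
      have h1 : |e a| ≤ C := abs_kmJ_le hp _
      have h2 : |B * q ^ a| ≤ |B| := by
        rw [abs_mul, abs_of_nonneg (pow_nonneg hq0.le a)]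
        exact mul_le_of_le_one_right (abs_nonneg B) (pow_le_one₀ hq0.le hq1.le)
      have h3 : A * p ^ a = e a - B * q ^ a := by rw [hform a]; ring
      calc |A| * p ^ a = |A * p ^ a| := by rw [abs_mul, abs_of_nonneg (pow_nonneg hp0.le a)]
        _ = |e a - B * q ^ a| := by rw [h3]
        _ ≤ |e a| + |B * q ^ a| := abs_sub _ _
        _ ≤ C + |B| := add_le_add h1 h2
    obtain ⟨n, hn⟩ := pow_unbounded_of_one_lt ((C + |B|) / |A|) hp
    have := hbd n
    rw [div_lt_iff₀ hApos] at hn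
    linarith
  -- hence `e 1 = e 0 / p` and `e 0 = 2πp/(p²-1)`
  have he1 : e 1 = e 0 * q := by
    have h := hAz
    rw [hA, div_eq_zero_iff] at h
    rcases h with h | h
    · linarith
    · exact absurd h hq
  have he0 : e 0 = 2 * π * p / (p ^ 2 - 1) := by
    rw [he1] at hrec0
    have h' : e 0 * (p - q) = 2 * π := by linarith [hrec0]
    rw [eq_div_iff hp21]
    linear_combination p * h' + e 0 * hpinv
  have hBe : B = e 0 := by
    have := hform 0
    simp only [pow_zero, mul_one, hAz, zero_add] at this
    exact this.symm
  have := hform a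
  rw [hAz, zero_mul, zero_add, hBe, he0] at this
  exact this

/-- `∫_{-π}^{π} g_p(θ) cos(cθ) dθ = ((p+1)/2π)(J_p(c) - (J_p(c+2) + J_p(c-2))/2)` (`sin²θ = (1 -
cos 2θ)/2`). [folklore] -/
theorem integral_kmDensity_mul_cos {p : ℝ} (hp : 1 < p) (c : ℝ) :
    ∫ θ in (-π)..π, kmDensity p θ * Real.cos (c * θ) =
      (p + 1) / (2 * π) * (kmJ p c - (kmJ p (c + 2) + kmJ p (c - 2)) / 2) := by
  have hi : ∀ c : ℝ, IntervalIntegrable (fun θ => Real.cos (c * θ) / kmDenom p θ) volume (-π) π :=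
    fun c => (continuous_cos_div_kmDenom hp c).intervalIntegrable (-π) π
  unfold kmJ
  rw [← intervalIntegral.integral_add (hi _) (hi _), ← intervalIntegral.integral_div,
    ← intervalIntegral.integral_sub (hi _) (((hi _).add (hi _)).div_const _),
    ← intervalIntegral.integral_const_mul]
  refine intervalIntegral.integral_congr fun θ _ => ?_
  have e : Real.cos ((c + 2) * θ) + Real.cos ((c - 2) * θ) =
      2 * Real.cos (c * θ) * Real.cos (2 * θ) := by
    rw [add_mul, sub_mul, Real.cos_add, Real.cos_sub]; ring
  have e' : Real.cos ((c + 2) * θ) =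
      2 * Real.cos (c * θ) * Real.cos (2 * θ) - Real.cos ((c - 2) * θ) := by linarith [e]
  rw [kmDensity, Real.sin_sq, Real.cos_sq θ, e']
  ring

/-- **`g_p` is a probability density**: `∫_{-π}^{π} g_p = 1` (Thm. 18: `c_0 = 1`). [cite:
MurtySinha2009, Thm. 18 p. 698] -/
theorem integral_kmDensity {p : ℝ} (hp : 1 < p) : ∫ θ in (-π)..π, kmDensity p θ = 1 := by
  have hp0 : 0 < p := by linarith
  have hp21 : p ^ 2 - 1 ≠ 0 := by nlinarith
  have h := integral_kmDensity_mul_cos hp 0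
  simp only [zero_mul, Real.cos_zero, mul_one, zero_add, zero_sub, kmJ_neg] at h
  rw [h]
  have h0 := kmJ_two_mul hp 0
  have h1 := kmJ_two_mul hp 1
  simp only [Nat.cast_zero, mul_zero, pow_zero, mul_one] at h0
  simp only [Nat.cast_one, mul_one, pow_one] at h1
  rw [h0, h1]
  field_simp
  ring

/-- **The even Weyl limits** (Thm. 18: `c_m = p^{-m/2} - p^{-(m-2)/2}` for `m` even): `∫_{-π}^{π}
g_p(θ) cos(2aθ) dθ = (p^{-a} - p^{-(a-1)})/2` for `a ≥ 1` (the factor `1/2` because `g_p` carries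
mass `1/2` on each of `[0, π]`, `[-π, 0]`). [cite: MurtySinha2009, Thm. 18 p. 698] -/
theorem integral_kmDensity_mul_cos_even {p : ℝ} (hp : 1 < p) {a : ℕ} (ha : 1 ≤ a) :
    ∫ θ in (-π)..π, kmDensity p θ * Real.cos (2 * a * θ) = (p⁻¹ ^ a - p⁻¹ ^ (a - 1)) / 2 := by
  have hp0 : 0 < p := by linarith
  have hpne : p ≠ 0 := hp0.ne'
  have hp21 : p ^ 2 - 1 ≠ 0 := by nlinarith
  obtain ⟨b, rfl⟩ : ∃ b, a = b + 1 := ⟨a - 1, by omega⟩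
  have h := integral_kmDensity_mul_cos hp (2 * (b + 1 : ℕ))
  rw [Nat.add_sub_cancel]
  push_cast at h ⊢
  rw [h, show (2 : ℝ) * (b + 1) + 2 = 2 * (b + 2 : ℕ) by push_cast; ring,
    show (2 : ℝ) * (b + 1) - 2 = 2 * (b : ℕ) by ring,
    show (2 : ℝ) * (b + 1) = 2 * (b + 1 : ℕ) by push_cast; ring,
    kmJ_two_mul hp, kmJ_two_mul hp, kmJ_two_mul hp]
  set E : ℝ := 2 * π * p / (p ^ 2 - 1) with hE
  have key : (p + 1) / (2 * π) * (E * p⁻¹ - (E * p⁻¹ ^ 2 + E) / 2) = (p⁻¹ - 1) / 2 := by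
    rw [hE]
    field_simp
    ring
  calc (p + 1) / (2 * π) * (E * p⁻¹ ^ (b + 1) - (E * p⁻¹ ^ (b + 2) + E * p⁻¹ ^ b) / 2)
      = p⁻¹ ^ b * ((p + 1) / (2 * π) * (E * p⁻¹ - (E * p⁻¹ ^ 2 + E) / 2)) := by ring
    _ = p⁻¹ ^ b * ((p⁻¹ - 1) / 2) := by rw [key]
    _ = (p⁻¹ ^ (b + 1) - p⁻¹ ^ b) / 2 := by ring

/-- **The odd Weyl limits vanish** (Thm. 18: `c_m = 0` for `m` odd): `∫_{-π}^{π} g_p(θ)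
cos((2a+1)θ) dθ = 0`. [cite: MurtySinha2009, Thm. 18 p. 698] -/
theorem integral_kmDensity_mul_cos_odd {p : ℝ} (hp : 1 < p) (a : ℕ) :
    ∫ θ in (-π)..π, kmDensity p θ * Real.cos ((2 * a + 1) * θ) = 0 := by
  rw [integral_kmDensity_mul_cos hp, kmJ_odd p a,
    show (2 : ℝ) * a + 1 + 2 = 2 * (a + 1 : ℕ) + 1 by push_cast; ring, kmJ_odd p (a + 1)]
  rcases Nat.eq_zero_or_pos a with rfl | ha
  · rw [show (2 : ℝ) * (0 : ℕ) + 1 - 2 = -(2 * (0 : ℕ) + 1) by push_cast; ring, kmJ_neg, kmJ_odd p 0]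
    ring
  · obtain ⟨b, rfl⟩ : ∃ b, a = b + 1 := ⟨a - 1, by omega⟩
    rw [show (2 : ℝ) * (b + 1 : ℕ) + 1 - 2 = 2 * (b : ℕ) + 1 by push_cast; ring, kmJ_odd p b]
    ring

/-- The sine coefficients of the even density `g_p` vanish. [folklore] -/
theorem integral_kmDensity_mul_sin (p c : ℝ) :
    ∫ θ in (-π)..π, kmDensity p θ * Real.sin (c * θ) = 0 := by
  have h : ∫ θ in (-π)..π, kmDensity p θ * Real.sin (c * θ) =
      ∫ θ in (-π)..π, (fun u => -(kmDensity p u * Real.sin (c * u))) (-θ) := by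
    refine intervalIntegral.integral_congr fun θ _ => ?_
    simp only [kmDensity_neg, mul_neg, Real.sin_neg, neg_neg]
  rw [intervalIntegral.integral_comp_neg (fun u => -(kmDensity p u * Real.sin (c * u))), neg_neg,
    intervalIntegral.integral_neg] at h
  linarith

end Fourier

/-! ### Counting lifts in arcs: ceiling bookkeeping -/

section Ceil

/-- `⌈y⌉ ≤ 1` for `y ≤ 1`. [folklore] -/
theorem ceil_le_one_of_le {y : ℝ} (h : y ≤ 1) : ⌈y⌉ ≤ 1 :=
  Int.ceil_le.mpr (by exact_mod_cast h)

/-- `⌈y⌉ ≤ 0` for `y ≤ 0`. [folklore] -/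
theorem ceil_nonpos_of_le {y : ℝ} (h : y ≤ 0) : ⌈y⌉ ≤ 0 :=
  Int.ceil_le.mpr (by exact_mod_cast h)

/-- `⌈y⌉ ≥ 0` for `y > -1`. [folklore] -/
theorem ceil_nonneg_of_lt {y : ℝ} (h : -1 < y) : 0 ≤ ⌈y⌉ := by
  have : (-1 : ℤ) < ⌈y⌉ := Int.lt_ceil.mpr (by exact_mod_cast h)
  omega

/-- `⌈y⌉ ≥ 1` for `y > 0`. [folklore] -/
theorem one_le_ceil_of_pos {y : ℝ} (h : 0 < y) : 1 ≤ ⌈y⌉ := by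
  have : (0 : ℤ) < ⌈y⌉ := Int.lt_ceil.mpr (by exact_mod_cast h)
  omega

/-- `arcCount u v P = ⌈(v-P)/2π⌉ - ⌈(u-P)/2π⌉ = #{k ∈ ℤ : u ≤ P + 2πk < v}`, the number of lifts of
the point `P ∈ ℝ/2πℤ` in the arc `[u, v)`, as a real number (the quantity bounded by
`Literature.Analysis.Fourier.abs_ceilCount_sub_integral_le`). [folklore] -/
noncomputable def arcCount (u v P : ℝ) : ℝ := (⌈(v - P) / (2 * π)⌉ - ⌈(u - P) / (2 * π)⌉ : ℤ)

/-- `arcCount u v P ≥ 0` for `u ≤ v`. [folklore] -/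
theorem arcCount_nonneg {u v : ℝ} (huv : u ≤ v) (P : ℝ) : 0 ≤ arcCount u v P := by
  have h2π : (0 : ℝ) < 2 * π := by positivity
  have : ⌈(u - P) / (2 * π)⌉ ≤ ⌈(v - P) / (2 * π)⌉ :=
    Int.ceil_mono (div_le_div_of_nonneg_right (by linarith) h2π.le)
  unfold arcCount
  exact_mod_cast sub_nonneg.mpr this

/-- `arcCount u v P = 1` when `0 < v - P ≤ 2π` and `-2π < u - P ≤ 0`. [folklore] -/
theorem arcCount_eq_one {u v P : ℝ} (hv1 : 0 < v - P) (hv2 : v - P ≤ 2 * π) (hu1 : -(2 * π) < u - P)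
    (hu2 : u - P ≤ 0) : arcCount u v P = 1 := by
  have h2π : (0 : ℝ) < 2 * π := by positivity
  have e1 : ⌈(v - P) / (2 * π)⌉ = 1 := by
    rw [Int.ceil_eq_iff]; push_cast
    exact ⟨by rw [sub_self]; exact div_pos hv1 h2π, by rw [div_le_one h2π]; exact hv2⟩
  have e2 : ⌈(u - P) / (2 * π)⌉ = 0 := by
    rw [Int.ceil_eq_iff]; push_cast
    refine ⟨?_, div_nonpos_of_nonpos_of_nonneg hu2 h2π.le⟩
    rw [zero_sub, neg_lt, ← neg_div, div_lt_one h2π]; linarith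
  unfold arcCount
  rw [e1, e2]; norm_num

/-- `arcCount u v P ≤ 1` when `v - P ≤ 2π` and `-2π < u - P`. [folklore] -/
theorem arcCount_le_one {u v P : ℝ} (hv : v - P ≤ 2 * π) (hu : -(2 * π) < u - P) :
    arcCount u v P ≤ 1 := by
  have h2π : (0 : ℝ) < 2 * π := by positivity
  have e1 : ⌈(v - P) / (2 * π)⌉ ≤ 1 := ceil_le_one_of_le (by rw [div_le_one h2π]; exact hv)
  have e2 : 0 ≤ ⌈(u - P) / (2 * π)⌉ :=
    ceil_nonneg_of_lt (by rw [neg_lt, ← neg_div, div_lt_one h2π]; linarith)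
  unfold arcCount
  have : (⌈(v - P) / (2 * π)⌉ - ⌈(u - P) / (2 * π)⌉ : ℤ) ≤ 1 := by omega
  exact_mod_cast this

/-- `arcCount u v P ≤ 0` when `v - P ≤ 0` and `-2π < u - P`. [folklore] -/
theorem arcCount_nonpos {u v P : ℝ} (hv : v - P ≤ 0) (hu : -(2 * π) < u - P) :
    arcCount u v P ≤ 0 := by
  have h2π : (0 : ℝ) < 2 * π := by positivity
  have e1 : ⌈(v - P) / (2 * π)⌉ ≤ 0 := ceil_nonpos_of_le (div_nonpos_of_nonpos_of_nonneg hv h2π.le)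
  have e2 : 0 ≤ ⌈(u - P) / (2 * π)⌉ :=
    ceil_nonneg_of_lt (by rw [neg_lt, ← neg_div, div_lt_one h2π]; linarith)
  unfold arcCount
  have : (⌈(v - P) / (2 * π)⌉ - ⌈(u - P) / (2 * π)⌉ : ℤ) ≤ 0 := by omega
  exact_mod_cast this

/-- `arcCount u v P ≤ 0` when `v - P ≤ 2π` and `0 < u - P`. [folklore] -/
theorem arcCount_nonpos' {u v P : ℝ} (hv : v - P ≤ 2 * π) (hu : 0 < u - P) :
    arcCount u v P ≤ 0 := by
  have h2π : (0 : ℝ) < 2 * π := by positivity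
  have e1 : ⌈(v - P) / (2 * π)⌉ ≤ 1 := ceil_le_one_of_le (by rw [div_le_one h2π]; exact hv)
  have e2 : 1 ≤ ⌈(u - P) / (2 * π)⌉ := one_le_ceil_of_pos (div_pos hu h2π)
  unfold arcCount
  have : (⌈(v - P) / (2 * π)⌉ - ⌈(u - P) / (2 * π)⌉ : ℤ) ≤ 0 := by omega
  exact_mod_cast this

end Ceil

section Arcs

variable {ι : Type*} [Fintype ι]

/-- **Upper count** (Murty–Sinha §10, p. 700: the angles `±θ_i` and the two intervals `I₁`, `I₂`):
for angles `θ_i ∈ [0, π]`, `0 ≤ θ_b ≤ θ_a ≤ π` and `0 < δ ≤ π`, twice the number of `i` with `θ_i ∈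
[θ_b, θ_a]` is at most the number of lifts of the `2#ι` points `±θ_i` in the enlarged arcs `[θ_b,
θ_a + δ)` and `[-θ_a, -θ_b + δ)`. [cite: MurtySinha2009, §10 p. 700] -/
theorem two_mul_card_le_arcCount (θ : ι → ℝ) (hθ : ∀ i, θ i ∈ Set.Icc 0 π) {θa θb δ : ℝ}
    (hb : 0 ≤ θb) (hba : θb ≤ θa) (ha : θa ≤ π) (hδ : 0 < δ) (hδπ : δ ≤ π) :
    2 * ((Finset.univ.filter fun i => θ i ∈ Set.Icc θb θa).card : ℝ) ≤
      ∑ i, (arcCount θb (θa + δ) (θ i) + arcCount θb (θa + δ) (-θ i)) +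
        ∑ i, (arcCount (-θa) (-θb + δ) (θ i) + arcCount (-θa) (-θb + δ) (-θ i)) := by
  classical
  have hcard : ((Finset.univ.filter fun i => θ i ∈ Set.Icc θb θa).card : ℝ) =
      ∑ i, if θ i ∈ Set.Icc θb θa then (1 : ℝ) else 0 := by
    rw [Finset.sum_boole]
  rw [hcard, Finset.mul_sum, ← Finset.sum_add_distrib]
  refine Finset.sum_le_sum fun i _ => ?_
  have h0 := (hθ i).1
  have hπ := (hθ i).2
  have n1 := arcCount_nonneg (by linarith : θb ≤ θa + δ) (θ i)
  have n2 := arcCount_nonneg (by linarith : θb ≤ θa + δ) (-θ i)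
  have n3 := arcCount_nonneg (by linarith : -θa ≤ -θb + δ) (θ i)
  have n4 := arcCount_nonneg (by linarith : -θa ≤ -θb + δ) (-θ i)
  split_ifs with hi
  · have e1 : arcCount θb (θa + δ) (θ i) = 1 :=
      arcCount_eq_one (by linarith [hi.2]) (by linarith [hi.1]) (by linarith [hi.2]) (by linarith [hi.1])
    have e4 : arcCount (-θa) (-θb + δ) (-θ i) = 1 :=
      arcCount_eq_one (by linarith [hi.1]) (by linarith [hi.2]) (by linarith) (by linarith [hi.2])
    linarith
  · linarith

/-- **Lower count** (loc. cit.): the number of lifts of the points `±θ_i` in the shrunken arcs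
`[θ_b + δ, θ_a)` and `[-θ_a + δ, -θ_b)` is at most twice the number of `i` with `θ_i ∈ [θ_b, θ_a]`.
[cite: MurtySinha2009, §10 p. 700] -/
theorem arcCount_le_two_mul_card (θ : ι → ℝ) (hθ : ∀ i, θ i ∈ Set.Icc 0 π) {θa θb δ : ℝ}
    (hb : 0 ≤ θb) (ha : θa ≤ π) (hδ : 0 < δ) (hδπ : δ ≤ π) :
    ∑ i, (arcCount (θb + δ) θa (θ i) + arcCount (θb + δ) θa (-θ i)) +
        ∑ i, (arcCount (-θa + δ) (-θb) (θ i) + arcCount (-θa + δ) (-θb) (-θ i)) ≤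
      2 * ((Finset.univ.filter fun i => θ i ∈ Set.Icc θb θa).card : ℝ) := by
  classical
  have hcard : ((Finset.univ.filter fun i => θ i ∈ Set.Icc θb θa).card : ℝ) =
      ∑ i, if θ i ∈ Set.Icc θb θa then (1 : ℝ) else 0 := by
    rw [Finset.sum_boole]
  rw [hcard, Finset.mul_sum, ← Finset.sum_add_distrib]
  refine Finset.sum_le_sum fun i _ => ?_
  have h0 := (hθ i).1
  have hπ := (hθ i).2
  -- the two cross terms are non-positive
  have c2 : arcCount (θb + δ) θa (-θ i) ≤ 0 :=
    arcCount_nonpos' (by linarith) (by linarith)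
  have c3 : arcCount (-θa + δ) (-θb) (θ i) ≤ 0 :=
    arcCount_nonpos (by linarith) (by linarith)
  split_ifs with hi
  · have c1 : arcCount (θb + δ) θa (θ i) ≤ 1 := arcCount_le_one (by linarith) (by linarith)
    have c4 : arcCount (-θa + δ) (-θb) (-θ i) ≤ 1 := arcCount_le_one (by linarith) (by linarith)
    linarith
  · rw [Set.mem_Icc, not_and_or, not_le, not_le] at hi
    rcases hi with hi | hi
    · have c1 : arcCount (θb + δ) θa (θ i) ≤ 0 := arcCount_nonpos' (by linarith) (by linarith)
      have c4 : arcCount (-θa + δ) (-θb) (-θ i) ≤ 0 := arcCount_nonpos (by linarith) (by linarith)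
      linarith
    · have c1 : arcCount (θb + δ) θa (θ i) ≤ 0 := arcCount_nonpos (by linarith) (by linarith)
      have c4 : arcCount (-θa + δ) (-θb) (-θ i) ≤ 0 := arcCount_nonpos' (by linarith) (by linarith)
      linarith

end Arcs

/-! ### From the eigenvalue variable `t = 2√p cos θ` to the angle -/

section Serre

/-- The density of Serre's measure `μ_p` in the un-normalised eigenvalue variable `t = √p x ∈
[-2√p, 2√p]`: `(p+1)√(4p - t²)/(2π((p+1)² - t²))` — the integrand of the vendored statement
`murtySinha2009_thm2_weightTwo` (Murty–Sinha Thm. 1/Thm. 2: `μ_p = ((p+1)/π)(1 -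
x²/4)^{1/2}/((p^{1/2} + p^{-1/2})² - x²) dx`, `x = t/√p`). [cite: MurtySinha2009, Thm. 1 p. 682] -/
noncomputable def serreDensity (p t : ℝ) : ℝ :=
  (p + 1) * Real.sqrt (4 * p - t ^ 2) / (2 * π * ((p + 1) ^ 2 - t ^ 2))

/-- Under `t = 2√p cos θ` (`θ ∈ [0, π]`) Serre's density pulls back to `2 g_p`: `ρ_p(2√p cos θ) ·
2√p sin θ = 2 g_p(θ)` (Murty–Sinha §9, p. 698: 'the distribution of the numbers `2cos θ_i` is given
by `μ_p`, after an easy change of variable'). [cite: MurtySinha2009, §9 p. 698] -/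
theorem serreDensity_two_mul_sqrt_mul_cos {p : ℝ} (hp : 1 < p) {θ : ℝ} (hθ : θ ∈ Set.Icc 0 π) :
    serreDensity p (2 * Real.sqrt p * Real.cos θ) * (2 * Real.sqrt p * Real.sin θ) =
      2 * kmDensity p θ := by
  have hp0 : 0 < p := by linarith
  have hpne : p ≠ 0 := hp0.ne'
  set s := Real.sqrt p with hs_def
  have hs : s ^ 2 = p := Real.sq_sqrt hp0.le
  have hs0 : 0 < s := Real.sqrt_pos.mpr hp0
  have hsin : 0 ≤ Real.sin θ := Real.sin_nonneg_of_nonneg_of_le_pi hθ.1 hθ.2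
  have h1 : Real.sqrt (4 * p - (2 * s * Real.cos θ) ^ 2) = 2 * s * Real.sin θ := by
    have : 4 * p - (2 * s * Real.cos θ) ^ 2 = (2 * s * Real.sin θ) ^ 2 := by
      rw [← hs]; nlinarith [Real.sin_sq_add_cos_sq θ]
    rw [this]
    exact Real.sqrt_sq (by positivity)
  have h2 : (p + 1) ^ 2 - (2 * s * Real.cos θ) ^ 2 = p * kmDenom p θ := by
    rw [kmDenom, Real.cos_two_mul, mul_sub, mul_add, mul_inv_cancel₀ hpne, ← hs]
    ring
  have hD := (kmDenom_pos hp θ).ne'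
  rw [serreDensity, h1, h2, kmDensity]
  field_simp
  rw [hs]

/-- Serre's density is continuous on `[-2√p, 2√p]` (`(p+1)² - t² ≥ (p-1)² > 0` there). [folklore] -/
theorem continuousOn_serreDensity {p : ℝ} (hp : 1 < p) :
    ContinuousOn (serreDensity p) (Set.Icc (-(2 * Real.sqrt p)) (2 * Real.sqrt p)) := by
  have hp0 : 0 < p := by linarith
  have hs : Real.sqrt p ^ 2 = p := Real.sq_sqrt hp0.le
  unfold serreDensity
  refine ContinuousOn.div (by fun_prop) (by fun_prop) fun t ht => ?_
  have ht2 : t ^ 2 ≤ 4 * p := by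
    have : |t| ≤ 2 * Real.sqrt p := abs_le.mpr ht
    nlinarith [abs_nonneg t, sq_abs t, Real.sqrt_nonneg p]
  have : 0 < (p + 1) ^ 2 - t ^ 2 := by nlinarith
  positivity

/-- **Change of variables** `t = 2√p cos θ`: for `α, β ∈ [-2√p, 2√p]`, `∫_α^β ρ_p(t) dt =
∫_{arccos(β/2√p)}^{arccos(α/2√p)} 2 g_p(θ) dθ`. [cite: MurtySinha2009, §9 p. 698] -/
theorem integral_serreDensity_eq {p : ℝ} (hp : 1 < p) {α β : ℝ}
    (hα : α ∈ Set.Icc (-(2 * Real.sqrt p)) (2 * Real.sqrt p))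
    (hβ : β ∈ Set.Icc (-(2 * Real.sqrt p)) (2 * Real.sqrt p)) :
    ∫ t in α..β, serreDensity p t =
      ∫ θ in Real.arccos (β / (2 * Real.sqrt p))..Real.arccos (α / (2 * Real.sqrt p)),
        2 * kmDensity p θ := by
  have hp0 : 0 < p := by linarith
  set s := Real.sqrt p with hs_def
  have hs0 : 0 < s := Real.sqrt_pos.mpr hp0
  have h2s : 0 < 2 * s := by positivity
  set θα := Real.arccos (α / (2 * s)) with hθα
  set θβ := Real.arccos (β / (2 * s)) with hθβ
  have hφα : 2 * s * Real.cos θα = α := by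
    rw [hθα, Real.cos_arccos] <;> [field_simp; (rw [le_div_iff₀ h2s]; linarith [hα.1]);
      (rw [div_le_one h2s]; exact hα.2)]
  have hφβ : 2 * s * Real.cos θβ = β := by
    rw [hθβ, Real.cos_arccos] <;> [field_simp; (rw [le_div_iff₀ h2s]; linarith [hβ.1]);
      (rw [div_le_one h2s]; exact hβ.2)]
  have hsub : Set.uIcc θβ θα ⊆ Set.Icc 0 π := by
    refine Set.uIcc_subset_Icc ⟨Real.arccos_nonneg _, Real.arccos_le_pi _⟩
      ⟨Real.arccos_nonneg _, Real.arccos_le_pi _⟩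
  have hderiv : ∀ x ∈ Set.uIcc θβ θα,
      HasDerivAt (fun y => 2 * s * Real.cos y) (-(2 * s * Real.sin x)) x := by
    intro x _
    simpa using (Real.hasDerivAt_cos x).const_mul (2 * s)
  have himage : (fun y => 2 * s * Real.cos y) '' Set.uIcc θβ θα ⊆ Set.Icc (-(2 * s)) (2 * s) := by
    rintro _ ⟨y, _, rfl⟩
    constructor <;> nlinarith [Real.cos_le_one y, Real.neg_one_le_cos y]
  have key := intervalIntegral.integral_comp_mul_deriv' (a := θβ) (b := θα)
    (g := serreDensity p) hderiv (by fun_prop) ((continuousOn_serreDensity hp).mono himage)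
  rw [hφα, hφβ, intervalIntegral.integral_symm α β] at key
  have e : ∫ θ in θβ..θα, ((serreDensity p) ∘ fun y => 2 * s * Real.cos y) θ * -(2 * s * Real.sin θ)
      = -∫ θ in θβ..θα, 2 * kmDensity p θ := by
    rw [← intervalIntegral.integral_neg]
    refine intervalIntegral.integral_congr fun θ hθ => ?_
    simp only [Function.comp_apply, mul_neg]
    rw [serreDensity_two_mul_sqrt_mul_cos hp (hsub hθ)]
  rw [e] at key
  linarith

end Serre

/-! ### `2 cos(dθ)` as a difference of Chebyshev polynomials of the second kind -/

section Cheb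

/-- `2cos((n+2)θ) = U_{n+2}(cos θ) - U_n(cos θ)` (Murty–Sinha §8, p. 697: `2cos mθ = X_m(2cos θ) -
X_{m-2}(2cos θ)`; Mathlib's `two_mul_T_eq_U_sub_U` and `T_real_cos`). [cite: MurtySinha2009, §8 p.
697] -/
theorem two_mul_cos_add_two_mul (θ : ℝ) (n : ℕ) :
    2 * Real.cos ((n + 2 : ℕ) * θ) =
      (Polynomial.Chebyshev.U ℝ (n + 2 : ℕ)).eval (Real.cos θ) -
        (Polynomial.Chebyshev.U ℝ n).eval (Real.cos θ) := by
  have h := congrArg (Polynomial.eval (Real.cos θ))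
    (Polynomial.Chebyshev.two_mul_T_eq_U_sub_U ℝ (n : ℤ))
  simp only [Polynomial.eval_mul, Polynomial.eval_ofNat, Polynomial.eval_sub,
    Polynomial.Chebyshev.T_real_cos] at h
  push_cast at h ⊢
  exact h

/-- `2cos θ = U_1(cos θ)` (the case `m = 1`, `X_{-1} = 0`). [cite: MurtySinha2009, §8 p. 697] -/
theorem two_mul_cos_eq_U_one (θ : ℝ) :
    2 * Real.cos θ = (Polynomial.Chebyshev.U ℝ (1 : ℕ)).eval (Real.cos θ) := by
  simp [Polynomial.Chebyshev.U_one]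

end Cheb

end MurtySinha

end Literature.NumberTheory.EllipticCurves.ModularForms
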